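import Mathlib.LinearAlgebra.BilinearForm.Orthogonal
import Mathlib.LinearAlgebra.Basis.VectorSpace
import Mathlib.LinearAlgebra.Pi
import HarnessLib

/-!
# Cell qa-qnc0 (rung F-Q1, density axis; toolkit for the NEAR-OUTSIDE lemma of planner qa-qnc0-p1,
# Sketch13 v6c `NearOutLemma`): PUNCTURING DUALITY and LINEAR EXTENSION for a linear code

For a linear code `C ≤ K^ι` and a set `S ⊆ ι` of coordinates ("outside"):

* `CodeDuality.mem_map_proj_of_orth` (puncturing duality): a vector `y` supported on `S` that is
  orthogonal to every `S`-supported dual word of `C` is the projection of a codeword: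
  `y ∈ C.map (proj S)`.  Proof: `y ∈ (C.map proj)^⊥⊥ = C.map proj` for the (nondegenerate, symmetric)
  dot form on `K^ι` (`LinearMap.BilinForm.orthogonal_orthogonal`), since the projection of any
  `w ∈ (C.map proj)^⊥` is an `S`-supported dual word.
* `CodeDuality.exists_coeffs_of_injOn` (linear extension): if codewords are determined by their
  `S`-coordinates, the value of a codeword at any coordinate `i₀` is a FIXED linear combination of
  its `S`-coordinates: `∃ λ, ∀ c ∈ C, c i₀ = Σ_i λ i · (proj S c) i` (`LinearMap.exists_extend`).

Standard linear algebra [folklore; e.g. MacWilliams–Sloane ch. 1 §9 (punctured and shortened codes)],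
stated for the cell's use in `NearOutLemma.lean`.  WHAT THIS IS NOT: nothing specific to `C_m`.
-/

namespace Summit.QuantumAdvantage.AdviceFreeQNC0

namespace CodeDuality

open Finset

variable {K : Type*} [Field K] {ι : Type*}

section Dot

variable [Fintype ι]

/-- The dot-product bilinear form on `K^ι`. -/
def dotForm (K : Type*) [Field K] (ι : Type*) [Fintype ι] : LinearMap.BilinForm K (ι → K) :=
  LinearMap.mk₂ K (fun x y => ∑ i, x i * y i)
    (fun x x' y => by simp only [Pi.add_apply, add_mul, sum_add_distrib])
    (fun c x y => by simp only [Pi.smul_apply, smul_eq_mul, mul_assoc, mul_sum])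
    (fun x y y' => by simp only [Pi.add_apply, mul_add, sum_add_distrib])
    (fun c x y => by simp only [Pi.smul_apply, smul_eq_mul, mul_sum, mul_left_comm])

/-- Unfolding `dotForm`. -/
@[simp] theorem dotForm_apply (x y : ι → K) : dotForm K ι x y = ∑ i, x i * y i := rfl

/-- The dot form is symmetric. -/
theorem dotForm_comm (x y : ι → K) : dotForm K ι x y = dotForm K ι y x := by
  simp only [dotForm_apply]; exact sum_congr rfl fun i _ => mul_comm _ _

/-- The dot form is reflexive. -/
theorem dotForm_isRefl : (dotForm K ι).IsRefl := fun x y h => by rw [dotForm_comm]; exact h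

/-- Pairing with a basis vector reads a coordinate. -/
theorem dotForm_single [DecidableEq ι] (x : ι → K) (i : ι) : dotForm K ι x (Pi.single i 1) = x i := by
  rw [dotForm_apply, Finset.sum_eq_single i]
  · simp
  · intro j _ hj; simp [Pi.single_eq_of_ne hj]
  · intro h; exact absurd (mem_univ i) h

/-- The dot form is nondegenerate. -/
theorem dotForm_nondegenerate [DecidableEq ι] : (dotForm K ι).Nondegenerate := by
  refine ⟨fun x hx => ?_, fun y hy => ?_⟩
  · funext i; rw [← dotForm_single x i]; exact hx _
  · funext i; rw [← dotForm_single y i, dotForm_comm]; exact hy _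

end Dot

/-- Projection onto the coordinates in `S` (zero elsewhere). -/
def proj (S : ι → Prop) [DecidablePred S] : (ι → K) →ₗ[K] (ι → K) where
  toFun x i := if S i then x i else 0
  map_add' x y := by funext i; simp only [Pi.add_apply]; split_ifs <;> simp
  map_smul' c x := by funext i; simp only [Pi.smul_apply, smul_eq_mul, RingHom.id_apply]; split_ifs <;> simp

/-- Unfolding `proj`. -/
@[simp] theorem proj_apply (S : ι → Prop) [DecidablePred S] (x : ι → K) (i : ι) :
    proj S x i = if S i then x i else 0 := rfl

/-- `proj` is self-adjoint for the dot form. -/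
theorem dotForm_proj_comm [Fintype ι] (S : ι → Prop) [DecidablePred S] (x y : ι → K) :
    dotForm K ι (proj S x) y = dotForm K ι x (proj S y) := by
  simp only [dotForm_apply, proj_apply]
  exact sum_congr rfl fun i _ => by split_ifs <;> simp

/-- A vector supported on `S` is its own projection. -/
theorem proj_eq_self_of_supp (S : ι → Prop) [DecidablePred S] {y : ι → K} (hy : ∀ i, ¬ S i → y i = 0) :
    proj S y = y := by
  funext i; simp only [proj_apply]; split_ifs with h
  · rfl
  · exact (hy i h).symm

/-- **Puncturing duality**: a vector supported on `S` and orthogonal to every `S`-supported dual word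
of `C` is the `S`-projection of a codeword. -/
theorem mem_map_proj_of_orth [Fintype ι] [DecidableEq ι] (C : Submodule K (ι → K)) (S : ι → Prop) [DecidablePred S] (y : ι → K)
    (hy : ∀ i, ¬ S i → y i = 0)
    (horth : ∀ r : ι → K, (∀ i, ¬ S i → r i = 0) → (∀ c ∈ C, dotForm K ι r c = 0) → dotForm K ι r y = 0) :
    y ∈ C.map (proj S) := by
  have key : y ∈ (dotForm K ι).orthogonal ((dotForm K ι).orthogonal (C.map (proj S))) := by
    rw [LinearMap.BilinForm.mem_orthogonal_iff]
    intro n hn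
    rw [LinearMap.BilinForm.mem_orthogonal_iff] at hn
    have h1 : dotForm K ι n y = dotForm K ι (proj S n) y := by
      conv_lhs => rw [← proj_eq_self_of_supp S hy]
      rw [dotForm_proj_comm]
    rw [h1]
    refine horth (proj S n) (fun i hi => by simp [hi]) (fun c hc => ?_)
    rw [dotForm_proj_comm, dotForm_comm]
    exact hn _ (Submodule.mem_map_of_mem hc)
  rwa [LinearMap.BilinForm.orthogonal_orthogonal dotForm_nondegenerate dotForm_isRefl] at key

/-- **Linear extension**: if codewords of `C` are determined by their `S`-coordinates, then for every
coordinate `i₀` there are coefficients `λ` with `c i₀ = Σ_i λ i · (proj S c) i` for all `c ∈ C`. -/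
theorem exists_coeffs_of_injOn [Fintype ι] [DecidableEq ι] (C : Submodule K (ι → K)) (S : ι → Prop) [DecidablePred S]
    (hinj : ∀ c ∈ C, proj S c = 0 → c = 0) (i₀ : ι) :
    ∃ lam : ι → K, ∀ c ∈ C, c i₀ = ∑ i, lam i * proj S c i := by
  -- the projection restricted to `C`, as a linear equivalence onto its image
  set W : Submodule K (ι → K) := C.map (proj S) with hW
  set P : C →ₗ[K] W := ((proj S).domRestrict C).codRestrict W
    (fun c => Submodule.mem_map_of_mem c.2) with hP
  have hPinj : Function.Injective P := by
    intro c c' h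
    apply Subtype.ext
    have h' : proj S (c.1 - c'.1) = 0 := by
      have := congrArg Subtype.val h
      simp only [hP, LinearMap.codRestrict_apply, LinearMap.domRestrict_apply] at this
      rw [map_sub, this, sub_self]
    have := hinj _ (C.sub_mem c.2 c'.2) h'
    exact sub_eq_zero.1 this
  have hPsurj : Function.Surjective P := by
    rintro ⟨w, hw⟩
    obtain ⟨c, hc, rfl⟩ := Submodule.mem_map.1 hw
    exact ⟨⟨c, hc⟩, rfl⟩
  set e : C ≃ₗ[K] W := LinearEquiv.ofBijective P ⟨hPinj, hPsurj⟩ with he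
  -- the functional "value at i₀" transported to `W`, extended to the whole space
  set φ : W →ₗ[K] K := ((LinearMap.proj i₀).comp C.subtype).comp e.symm.toLinearMap with hφ
  obtain ⟨ψ, hψ⟩ := LinearMap.exists_extend φ
  refine ⟨fun i => ψ (Pi.single i 1), fun c hc => ?_⟩
  have h1 : c i₀ = φ (e ⟨c, hc⟩) := by
    show c i₀ = ((LinearMap.proj i₀).comp C.subtype) (e.symm (e ⟨c, hc⟩))
    rw [LinearEquiv.symm_apply_apply]
    rfl
  have h2 : (e ⟨c, hc⟩ : ι → K) = proj S c := by
    simp only [he, LinearEquiv.ofBijective_apply, hP, LinearMap.codRestrict_apply,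
      LinearMap.domRestrict_apply]
  have h3 : φ (e ⟨c, hc⟩) = ψ (proj S c) := by
    rw [← h2, ← hψ]; rfl
  rw [h1, h3, LinearMap.pi_apply_eq_sum_univ ψ (proj S c)]
  refine sum_congr rfl fun i _ => ?_
  rw [smul_eq_mul, mul_comm]
  congr 1
  congr 1
  funext j
  rw [Pi.single_apply]
  rcases eq_or_ne i j with rfl | h
  · simp
  · rw [if_neg h, if_neg (Ne.symm h)]

end CodeDuality

end Summit.QuantumAdvantage.AdviceFreeQNC0
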